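import Literature.Analysis.FluidPDE.NSSereginMildCompactnessHolds
import Literature.Analysis.FluidPDE.JiaSverak2014SlabAprioriEstimate
import Literature.Analysis.FluidPDE.LocalLerayPressureBoundHolds
import Literature.Analysis.FluidPDE.LerayHopfMild
import Literature.Analysis.UnboundedOperators.HeatExtensionDecay
import HarnessLib

/-!
# Barker–Prange 2020, Theorem 2 by compactness: extraction of the limit local energy solution

Analysis/FluidPDE proof file (theorems only: no definitions, no named facts — D-0026), part of
the compactness proof of the named fact `Literature.Analysis.FluidPDE.BarkerPrange2020_thm2`
(`BarkerPrangeConcentration.lean`; T. Barker, C. Prange, Arch. Ration. Mech. Anal. 236 (2020) =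
arXiv:1812.09115, Theorem 2; the line is described in `BarkerPrangeConcentrationCompactness.lean`).

Given the sequence of rescaled violators — unit-viscosity local energy solutions `(v₀ⁿ, vⁿ, πⁿ)`
on `ℝ³ × (0, σ)` with data in `L²(ℝ³)`, `‖v₀ⁿ‖_{L²(B₁(x̄))} ≤ M`, `‖v₀ⁿ‖_{L³(B(0, Rₙ))} ≤ γ`,
`Rₙ → ∞` — this file runs Seregin's limiting procedure (Seregin 2014, Ch. 7 §7.3 and App. B
§B.4 = Kikuchi–Seregin 2007; Lemarié-Rieusset 2016, proof of Thm. 15.5, pp. 570–571) and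
identifies the limit as a local energy solution on the same strip whose datum is `γ`-small in
`L³(ℝ³)`. The pieces are theorems of the tree — `JiaSverak2014.apriori_unit_scale_slab`
(uniform bounds on `(0, σ)` for `σ ≤ σ₀(M)`), `seregin2014_localEnergy_limitingProcedure_holds`
(F1), `seregin2014_limit_decay_holds` (F2), `kangMiuraTsai_local_pressure_bound_holds`, the glue
of `NSSereginMildCompactness.lean` — and ONE external input written out as an inline hypothesis:
the **uniform local initial layer** near the origin (`hLayer`, the subject of the sequel files).
Relative to the tree's `lemarieRieusset_localLeray_compactness_of_parts` (data bounded in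
`L³(ℝ³)`), two points change: the `L³` bound of the limit datum comes from the LOCAL bounds
(every test field is eventually supported in `B(0, Rₙ)`), and the caloric extensions of the data
converge against test fields under uniformly LOCAL `L²` bounds only
(`tendsto_integral_inner_of_forall_ball_le`: pairings of such sequences against smooth fields
decaying like `(1 + |x|)⁻⁴` converge; the caloric extension of a test field is such a field,
`UnboundedOperators.exists_pow_mul_norm_heatExtension_le`).

## Contents

* `IsLocalEnergySolutionOn.forall_lintegral_ball_le_of_ae` — the every-time unit-ball bound of
  a local energy solution from an a.e.-in-time one (weak continuity and duality).
* `tendsto_integral_inner_of_forall_ball_le`, `tendsto_integral_inner_heatTest_of_forall_ball_le`,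
  `eLpNorm_sub_heatTest_le_of_tendsto'` — the convergence tools described above.
* `exists_limit_localEnergySolution` — the extraction theorem.

## References

* T. Barker, C. Prange, ARMA 236 (2020) = arXiv:1812.09115, Thm. 2, §4.2. [BarkerPrange2020]
* G. Seregin, *Lecture Notes on Regularity Theory for the Navier–Stokes Equations* (2014),
  Ch. 7 §7.3, App. B §B.4. [Seregin2014]
* P. G. Lemarié-Rieusset, *The Navier–Stokes Problem in the 21st Century* (2016), proof of
  Thm. 15.5, pp. 570–571. [LemarieRieusset2016]
* K. Kang, H. Miura, T.-P. Tsai, IMRN 2021 = arXiv:1812.10509, Lemmas 3.3–3.5. [KangMiuraTsai2020]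
-/

noncomputable section

open MeasureTheory Set Function Filter Metric Topology TopologicalSpace
open scoped ENNReal NNReal RealInnerProductSpace

namespace Literature.Analysis.FluidPDE

namespace BarkerPrange2020

/-! ### Tools: unit-ball bounds and pairings against decaying fields -/

/-- **Unit-ball `L¹` bounds from unit-ball `L²` bounds** (Cauchy–Schwarz on the unit ball):
`∫_{B₁(z)} |f| ≤ A^{1/2} |B₁|^{1/2}`. [folklore] -/
theorem lintegral_ball_enorm_le_of_sq {f : EuclideanSpace ℝ (Fin 3) → EuclideanSpace ℝ (Fin 3)}
    (hf : AEStronglyMeasurable f volume) {A : ℝ≥0∞}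
    (hA : ∀ z : EuclideanSpace ℝ (Fin 3), ∫⁻ y in ball z 1, ‖f y‖ₑ ^ 2 ≤ A)
    (z : EuclideanSpace ℝ (Fin 3)) :
    ∫⁻ y in ball z 1, ‖f y‖ₑ ≤
      A ^ (1 / 2 : ℝ) * volume (ball (0 : EuclideanSpace ℝ (Fin 3)) 1) ^ (1 / 2 : ℝ) := by
  set μ : Measure (EuclideanSpace ℝ (Fin 3)) := volume.restrict (ball z 1) with hμ
  have h := eLpNorm_le_eLpNorm_mul_rpow_measure_univ (by norm_num : (1 : ℝ≥0∞) ≤ 2)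
    (hf.restrict : AEStronglyMeasurable f μ)
  rw [eLpNorm_one_eq_lintegral_enorm] at h
  have hexp : (1 / (1 : ℝ≥0∞).toReal - 1 / (2 : ℝ≥0∞).toReal : ℝ) = 1 / 2 := by norm_num
  have hvol : μ univ = volume (ball (0 : EuclideanSpace ℝ (Fin 3)) 1) := by
    rw [hμ, Measure.restrict_apply_univ, Measure.addHaar_ball_center]
  rw [hexp, hvol] at h
  exact h.trans (mul_le_mul' (eLpNorm_two_le_rpow_of_lintegral_sq_le (hA z)) le_rfl)

/-- **Pairings against decaying fields are integrable** for a uniformly local field: if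
`∫ |f| (1 + |y|)⁻⁴ < ∞` and `‖g‖ ≤ B (1 + |y|)⁻⁴` with `g` continuous, then `⟪f, g⟫ ∈ L¹`, with
`∫ |⟪f, g⟫| 1_{S} ≤ B ∫_S |f| (1 + |y|)⁻⁴` for the set `S` off which `g` vanishes. [folklore] -/
theorem integrable_inner_of_decay {f g : EuclideanSpace ℝ (Fin 3) → EuclideanSpace ℝ (Fin 3)}
    (hf : AEStronglyMeasurable f volume)
    (hfw : ∫⁻ y, ‖f y‖ₑ * ENNReal.ofReal (((1 + ‖y - 0‖) ^ 4)⁻¹) < ∞)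
    (hg : Continuous g) {B : ℝ} (hB : ∀ y, ‖g y‖ ≤ B * ((1 + ‖y‖) ^ 4)⁻¹) :
    Integrable (fun y => ⟪f y, g y⟫) volume := by
  have hB0 : 0 ≤ B := by
    have h := hB 0
    rw [norm_zero, add_zero, one_pow, inv_one, mul_one] at h
    exact (norm_nonneg _).trans h
  -- the dominating function `B |f| (1 + |y|)⁻⁴`
  set h₀ : EuclideanSpace ℝ (Fin 3) → ℝ := fun y => ‖f y‖ * ((1 + ‖y‖) ^ 4)⁻¹ with hh₀
  have hh₀m : AEStronglyMeasurable h₀ volume :=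
    hf.norm.mul (Measurable.aestronglyMeasurable (by fun_prop))
  have hh₀nn : ∀ y, 0 ≤ h₀ y := fun y => by positivity
  have hh₀i : Integrable h₀ volume := by
    refine ⟨hh₀m, ?_⟩
    rw [hasFiniteIntegral_iff_ofReal (Eventually.of_forall hh₀nn)]
    refine lt_of_le_of_lt (le_of_eq (lintegral_congr fun y => ?_)) hfw
    rw [hh₀, ENNReal.ofReal_mul (norm_nonneg _), ofReal_norm, sub_zero]
  refine Integrable.mono' (hh₀i.const_mul B) (hf.inner hg.aestronglyMeasurable)
    (Eventually.of_forall fun y => ?_)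
  calc ‖⟪f y, g y⟫‖ ≤ ‖f y‖ * ‖g y‖ := norm_inner_le_norm _ _
    _ ≤ ‖f y‖ * (B * ((1 + ‖y‖) ^ 4)⁻¹) := mul_le_mul_of_nonneg_left (hB y) (norm_nonneg _)
    _ = B * h₀ y := by rw [hh₀]; ring

/-- **The tail of a pairing against a decaying field**: if moreover `g` vanishes on
`closedBall 0 ρ`, then `|∫⟪f, g⟫| ≤ B ∫_{|y| > ρ} |f| (1 + |y|)⁻⁴`. [folklore] -/
theorem abs_integral_inner_le_tail {f g : EuclideanSpace ℝ (Fin 3) → EuclideanSpace ℝ (Fin 3)}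
    (hf : AEStronglyMeasurable f volume)
    (hfw : ∫⁻ y, ‖f y‖ₑ * ENNReal.ofReal (((1 + ‖y - 0‖) ^ 4)⁻¹) < ∞)
    (hg : Continuous g) {B : ℝ} (hB : ∀ y, ‖g y‖ ≤ B * ((1 + ‖y‖) ^ 4)⁻¹) {ρ : ℝ}
    (hg0 : ∀ y ∈ closedBall (0 : EuclideanSpace ℝ (Fin 3)) ρ, g y = 0) :
    |∫ y, ⟪f y, g y⟫| ≤ B * (∫⁻ y in (closedBall (0 : EuclideanSpace ℝ (Fin 3)) ρ)ᶜ,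
      ‖f y‖ₑ * ENNReal.ofReal (((1 + ‖y - 0‖) ^ 4)⁻¹)).toReal := by
  have hB0 : 0 ≤ B := by
    have h := hB 0
    rw [norm_zero, add_zero, one_pow, inv_one, mul_one] at h
    exact (norm_nonneg _).trans h
  set S : Set (EuclideanSpace ℝ (Fin 3)) := (closedBall (0 : EuclideanSpace ℝ (Fin 3)) ρ)ᶜ with hS
  have hSm : MeasurableSet S := measurableSet_closedBall.compl
  set h₀ : EuclideanSpace ℝ (Fin 3) → ℝ := fun y => ‖f y‖ * ((1 + ‖y‖) ^ 4)⁻¹ with hh₀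
  have hh₀m : AEStronglyMeasurable h₀ volume :=
    hf.norm.mul (Measurable.aestronglyMeasurable (by fun_prop))
  have hh₀nn : ∀ y, 0 ≤ h₀ y := fun y => by positivity
  have heq : ∀ y, ENNReal.ofReal (h₀ y) = ‖f y‖ₑ * ENNReal.ofReal (((1 + ‖y - 0‖) ^ 4)⁻¹) := fun y => by
    rw [hh₀, ENNReal.ofReal_mul (norm_nonneg _), ofReal_norm, sub_zero]
  have hh₀i : Integrable h₀ volume := by
    refine ⟨hh₀m, ?_⟩
    rw [hasFiniteIntegral_iff_ofReal (Eventually.of_forall hh₀nn)]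
    exact lt_of_le_of_lt (le_of_eq (lintegral_congr heq)) hfw
  -- pointwise domination by the indicator of the tail
  have hdom : ∀ y, ‖⟪f y, g y⟫‖ ≤ S.indicator (fun y => B * h₀ y) y := by
    intro y
    by_cases hy : y ∈ S
    · rw [indicator_of_mem hy]
      calc ‖⟪f y, g y⟫‖ ≤ ‖f y‖ * ‖g y‖ := norm_inner_le_norm _ _
        _ ≤ ‖f y‖ * (B * ((1 + ‖y‖) ^ 4)⁻¹) := mul_le_mul_of_nonneg_left (hB y) (norm_nonneg _)
        _ = B * h₀ y := by rw [hh₀]; ring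
    · rw [indicator_of_notMem hy]
      have hy' : y ∈ closedBall (0 : EuclideanSpace ℝ (Fin 3)) ρ := by
        rw [hS, mem_compl_iff, not_not] at hy; exact hy
      rw [hg0 y hy', inner_zero_right, norm_zero]
  have hind : Integrable (S.indicator fun y => B * h₀ y) volume :=
    (hh₀i.const_mul B).indicator hSm
  calc |∫ y, ⟪f y, g y⟫| = ‖∫ y, ⟪f y, g y⟫‖ := (Real.norm_eq_abs _).symm
    _ ≤ ∫ y, ‖⟪f y, g y⟫‖ := norm_integral_le_integral_norm _
    _ ≤ ∫ y, S.indicator (fun y => B * h₀ y) y :=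
        integral_mono (integrable_inner_of_decay hf hfw hg hB).norm hind hdom
    _ = B * ∫ y in S, h₀ y := by rw [integral_indicator hSm, integral_const_mul]
    _ = B * (∫⁻ y in S, ‖f y‖ₑ * ENNReal.ofReal (((1 + ‖y - 0‖) ^ 4)⁻¹)).toReal := by
        congr 1
        rw [integral_eq_lintegral_of_nonneg_ae (Eventually.of_forall hh₀nn) hh₀m.restrict]
        congr 1
        exact lintegral_congr heq

/-- `(1 + r)⁴ ≤ 8 (1 + r⁴)`. [folklore] -/
theorem one_add_pow_four_le (r : ℝ) : (1 + r) ^ 4 ≤ 8 * (1 + r ^ 4) := by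
  have h : 8 * (1 + r ^ 4) - (1 + r) ^ 4 = (r - 1) ^ 2 * (7 * r ^ 2 + 10 * r + 7) := by ring
  have h2 : 0 ≤ (r - 1) ^ 2 * (7 * r ^ 2 + 10 * r + 7) :=
    mul_nonneg (sq_nonneg _) (by nlinarith [sq_nonneg (r + 5 / 7)])
  linarith

/-- **The caloric extension of a test field decays like `(1 + |y|)⁻⁴`** (Gaussian tails;
`UnboundedOperators.exists_pow_mul_norm_heatExtension_le` with `k = 0, 4`). [folklore] -/
theorem exists_norm_heatExtension_le_inv_one_add_pow
    {g : EuclideanSpace ℝ (Fin 3) → EuclideanSpace ℝ (Fin 3)} (hg : Continuous g)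
    (hgc : HasCompactSupport g) {s : ℝ} (hs : 0 < s) :
    ∃ B : ℝ, 0 ≤ B ∧ ∀ y : EuclideanSpace ℝ (Fin 3),
      ‖UnboundedOperators.heatExtension g s y‖ ≤ B * ((1 + ‖y‖) ^ 4)⁻¹ := by
  obtain ⟨C₀, hC₀, h₀⟩ := UnboundedOperators.exists_pow_mul_norm_heatExtension_le hg hgc hs 0
  obtain ⟨C₄, hC₄, h₄⟩ := UnboundedOperators.exists_pow_mul_norm_heatExtension_le hg hgc hs 4
  refine ⟨8 * (C₀ + C₄), by positivity, fun y => ?_⟩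
  have hpos : 0 < (1 + ‖y‖) ^ 4 := by positivity
  rw [← div_eq_mul_inv, le_div_iff₀ hpos]
  have h0' : ‖UnboundedOperators.heatExtension g s y‖ ≤ C₀ := by simpa using h₀ y
  have h4' := h₄ y
  calc ‖UnboundedOperators.heatExtension g s y‖ * (1 + ‖y‖) ^ 4
      ≤ ‖UnboundedOperators.heatExtension g s y‖ * (8 * (1 + ‖y‖ ^ 4)) :=
        mul_le_mul_of_nonneg_left (one_add_pow_four_le _) (norm_nonneg _)
    _ = 8 * (‖UnboundedOperators.heatExtension g s y‖ +
        ‖y‖ ^ 4 * ‖UnboundedOperators.heatExtension g s y‖) := by ring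
    _ ≤ 8 * (C₀ + C₄) := by gcongr

/-- **Pairings of uniformly locally bounded, weakly convergent sequences against decaying
smooth fields converge.** If the fields `a n`, `aL` satisfy `∫_{B₁(z)} |·|² ≤ A < ∞` for all
`z`, and `∫⟪a n, ψ⟫ → ∫⟪aL, ψ⟫` for every test field `ψ`, then `∫⟪a n, g⟫ → ∫⟪aL, g⟫` for every
smooth `g` with `‖g(y)‖ ≤ B (1 + |y|)⁻⁴` (truncate `g` with a smooth cut-off: the truncated
field is a test field, and the tails are uniformly small,
`exists_radius_lintegral_tail_weight_le`). [folklore] -/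
theorem tendsto_integral_inner_of_forall_ball_le
    {a : ℕ → EuclideanSpace ℝ (Fin 3) → EuclideanSpace ℝ (Fin 3)}
    {aL : EuclideanSpace ℝ (Fin 3) → EuclideanSpace ℝ (Fin 3)} {A : ℝ≥0∞} (hAtop : A ≠ ∞)
    (ham : ∀ n, AEStronglyMeasurable (a n) volume)
    (haA : ∀ n, ∀ z : EuclideanSpace ℝ (Fin 3), ∫⁻ y in ball z 1, ‖a n y‖ₑ ^ 2 ≤ A)
    (haLm : AEStronglyMeasurable aL volume)
    (haLA : ∀ z : EuclideanSpace ℝ (Fin 3), ∫⁻ y in ball z 1, ‖aL y‖ₑ ^ 2 ≤ A)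
    (h : ∀ ψ : EuclideanSpace ℝ (Fin 3) → EuclideanSpace ℝ (Fin 3),
      FunctionSpaces.IsTestFunctionOn (⊤ : Opens (EuclideanSpace ℝ (Fin 3))) ψ →
        Tendsto (fun n => ∫ x, ⟪a n x, ψ x⟫) atTop (𝓝 (∫ x, ⟪aL x, ψ x⟫)))
    {g : EuclideanSpace ℝ (Fin 3) → EuclideanSpace ℝ (Fin 3)} (hg : ContDiff ℝ (⊤ : ℕ∞) g)
    {B : ℝ} (hB : ∀ y, ‖g y‖ ≤ B * ((1 + ‖y‖) ^ 4)⁻¹) :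
    Tendsto (fun n => ∫ x, ⟪a n x, g x⟫) atTop (𝓝 (∫ x, ⟪aL x, g x⟫)) := by
  have hB0 : 0 ≤ B := by
    have h := hB 0
    rw [norm_zero, add_zero, one_pow, inv_one, mul_one] at h
    exact (norm_nonneg _).trans h
  have hgc : Continuous g := hg.continuous
  -- unit-ball `L¹` bounds and the weighted integrability of all the fields
  set V : ℝ≥0∞ := volume (ball (0 : EuclideanSpace ℝ (Fin 3)) 1) with hV
  have hVtop : V ≠ ∞ := measure_ball_lt_top.ne
  set A₁ : ℝ≥0∞ := A ^ (1 / 2 : ℝ) * V ^ (1 / 2 : ℝ) with hA₁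
  have hA₁top : A₁ ≠ ∞ := ENNReal.mul_ne_top (ENNReal.rpow_ne_top_of_nonneg (by norm_num) hAtop)
    (ENNReal.rpow_ne_top_of_nonneg (by norm_num) hVtop)
  obtain ⟨Cw, hCwtop, hCw⟩ := exists_lintegral_mul_inv_one_add_norm_pow_le
  have hfw : ∀ {f : EuclideanSpace ℝ (Fin 3) → EuclideanSpace ℝ (Fin 3)}, AEStronglyMeasurable f volume →
      (∀ z : EuclideanSpace ℝ (Fin 3), ∫⁻ y in ball z 1, ‖f y‖ₑ ^ 2 ≤ A) →
      ∫⁻ y, ‖f y‖ₑ * ENNReal.ofReal (((1 + ‖y - 0‖) ^ 4)⁻¹) < ∞ := by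
    intro f hf hfA
    refine lt_of_le_of_lt (hCw (fun y => ‖f y‖ₑ) hf.enorm A₁ (lintegral_ball_enorm_le_of_sq hf hfA) 0) ?_
    exact ENNReal.mul_lt_top hCwtop.lt_top hA₁top.lt_top
  rw [Metric.tendsto_atTop]
  intro ε hε
  -- the tail radius
  set δ : ℝ := ε / (3 * (B + 1)) with hδ
  have hδ0 : 0 < δ := by rw [hδ]; positivity
  set ε₁ : ℝ≥0∞ := ENNReal.ofReal δ / (A₁ + 1) with hε₁
  have hε₁0 : 0 < ε₁ := ENNReal.div_pos (ENNReal.ofReal_pos.2 hδ0).ne' (by simp [hA₁top])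
  have hε₁A : ε₁ * A₁ ≤ ENNReal.ofReal δ := by
    calc ε₁ * A₁ ≤ ε₁ * (A₁ + 1) := by gcongr; exact le_self_add
      _ = ENNReal.ofReal δ := ENNReal.div_mul_cancel (by simp) (by simp [hA₁top])
  obtain ⟨ρ, hρ⟩ := exists_radius_lintegral_tail_weight_le (0 : EuclideanSpace ℝ (Fin 3)) hε₁0
  have htail : ∀ {f : EuclideanSpace ℝ (Fin 3) → EuclideanSpace ℝ (Fin 3)}, AEStronglyMeasurable f volume →
      (∀ z : EuclideanSpace ℝ (Fin 3), ∫⁻ y in ball z 1, ‖f y‖ₑ ^ 2 ≤ A) →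
      ∀ {g' : EuclideanSpace ℝ (Fin 3) → EuclideanSpace ℝ (Fin 3)}, Continuous g' →
        (∀ y, ‖g' y‖ ≤ B * ((1 + ‖y‖) ^ 4)⁻¹) →
        (∀ y ∈ closedBall (0 : EuclideanSpace ℝ (Fin 3)) ρ, g' y = 0) →
        |∫ y, ⟪f y, g' y⟫| ≤ ε / 3 := by
    intro f hf hfA g' hg' hBg' hg'0
    refine (abs_integral_inner_le_tail hf (hfw hf hfA) hg' hBg' hg'0).trans ?_
    have h1 := hρ (fun y => ‖f y‖ₑ) hf.enorm A₁ (lintegral_ball_enorm_le_of_sq hf hfA)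
    have h2 : (∫⁻ y in (closedBall (0 : EuclideanSpace ℝ (Fin 3)) ρ)ᶜ,
        ‖f y‖ₑ * ENNReal.ofReal (((1 + ‖y - 0‖) ^ 4)⁻¹)).toReal ≤ δ :=
      ENNReal.toReal_le_of_le_ofReal hδ0.le (h1.trans hε₁A)
    calc B * (∫⁻ y in (closedBall (0 : EuclideanSpace ℝ (Fin 3)) ρ)ᶜ,
          ‖f y‖ₑ * ENNReal.ofReal (((1 + ‖y - 0‖) ^ 4)⁻¹)).toReal ≤ B * δ := by gcongr
      _ ≤ (B + 1) * δ := by gcongr; linarith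
      _ = ε / 3 := by rw [hδ]; field_simp
  -- the smooth cut-off and the splitting `g = ψ + g'`
  set ρ' : ℝ := max ρ 1 with hρ'
  let χ : ContDiffBump (0 : EuclideanSpace ℝ (Fin 3)) := ⟨ρ', ρ' + 1, by positivity, by linarith⟩
  set ψ : EuclideanSpace ℝ (Fin 3) → EuclideanSpace ℝ (Fin 3) := fun y => (χ : EuclideanSpace ℝ (Fin 3) → ℝ) y • g y
    with hψ_def
  set g' : EuclideanSpace ℝ (Fin 3) → EuclideanSpace ℝ (Fin 3) := fun y => g y - ψ y with hg'_def
  have hψ : FunctionSpaces.IsTestFunctionOn (⊤ : Opens (EuclideanSpace ℝ (Fin 3))) ψ :=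
    isTestFunctionOn_top_of_contDiff_of_hasCompactSupport (χ.contDiff.smul hg)
      (χ.hasCompactSupport.smul_right)
  have hψc : Continuous ψ := hψ.contDiff.continuous
  have hg'c : Continuous g' := hgc.sub hψc
  have hχ01 : ∀ y, 0 ≤ (χ : EuclideanSpace ℝ (Fin 3) → ℝ) y ∧ (χ : EuclideanSpace ℝ (Fin 3) → ℝ) y ≤ 1 :=
    fun y => ⟨χ.nonneg, χ.le_one⟩
  have hBψ : ∀ y, ‖ψ y‖ ≤ B * ((1 + ‖y‖) ^ 4)⁻¹ := fun y => by
    rw [hψ_def]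
    dsimp only
    rw [norm_smul, Real.norm_eq_abs, abs_of_nonneg (hχ01 y).1]
    calc (χ : EuclideanSpace ℝ (Fin 3) → ℝ) y * ‖g y‖ ≤ 1 * ‖g y‖ :=
          mul_le_mul_of_nonneg_right (hχ01 y).2 (norm_nonneg _)
      _ ≤ B * ((1 + ‖y‖) ^ 4)⁻¹ := by rw [one_mul]; exact hB y
  have hBg' : ∀ y, ‖g' y‖ ≤ B * ((1 + ‖y‖) ^ 4)⁻¹ := fun y => by
    rw [hg'_def, hψ_def]
    dsimp only
    rw [show g y - (χ : EuclideanSpace ℝ (Fin 3) → ℝ) y • g y =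
        (1 - (χ : EuclideanSpace ℝ (Fin 3) → ℝ) y) • g y by rw [sub_smul, one_smul],
      norm_smul, Real.norm_eq_abs, abs_of_nonneg (by linarith [(hχ01 y).2])]
    calc (1 - (χ : EuclideanSpace ℝ (Fin 3) → ℝ) y) * ‖g y‖ ≤ 1 * ‖g y‖ :=
          mul_le_mul_of_nonneg_right (by linarith [(hχ01 y).1]) (norm_nonneg _)
      _ ≤ B * ((1 + ‖y‖) ^ 4)⁻¹ := by rw [one_mul]; exact hB y
  have hg'0 : ∀ y ∈ closedBall (0 : EuclideanSpace ℝ (Fin 3)) ρ, g' y = 0 := by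
    intro y hy
    have hy' : y ∈ closedBall (0 : EuclideanSpace ℝ (Fin 3)) χ.rIn := by
      rw [mem_closedBall] at hy ⊢
      exact hy.trans (le_max_left _ _)
    rw [hg'_def, hψ_def]
    dsimp only
    rw [χ.one_of_mem_closedBall hy', one_smul, sub_self]
  -- splitting the pairings
  have hsplit : ∀ {f : EuclideanSpace ℝ (Fin 3) → EuclideanSpace ℝ (Fin 3)}, AEStronglyMeasurable f volume →
      (∀ z : EuclideanSpace ℝ (Fin 3), ∫⁻ y in ball z 1, ‖f y‖ₑ ^ 2 ≤ A) →
      ∫ y, ⟪f y, g y⟫ = (∫ y, ⟪f y, g' y⟫) + ∫ y, ⟪f y, ψ y⟫ := by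
    intro f hf hfA
    rw [← integral_add (integrable_inner_of_decay hf (hfw hf hfA) hg'c hBg')
      (integrable_inner_of_decay hf (hfw hf hfA) hψc hBψ)]
    refine integral_congr_ae (Eventually.of_forall fun y => ?_)
    show ⟪f y, g y⟫ = ⟪f y, g' y⟫ + ⟪f y, ψ y⟫
    rw [← inner_add_right, hg'_def]
    dsimp only
    rw [sub_add_cancel]
  obtain ⟨N, hN⟩ := (Metric.tendsto_atTop.1 (h ψ hψ)) (ε / 3) (by positivity)
  refine ⟨N, fun n hn => ?_⟩
  have h1 := htail (ham n) (haA n) hg'c hBg' hg'0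
  have h2 := htail haLm haLA hg'c hBg' hg'0
  have h3 := hN n hn
  rw [Real.dist_eq] at h3 ⊢
  rw [hsplit (ham n) (haA n), hsplit haLm haLA]
  have e : ((∫ y, ⟪a n y, g' y⟫) + ∫ y, ⟪a n y, ψ y⟫) - ((∫ y, ⟪aL y, g' y⟫) + ∫ y, ⟪aL y, ψ y⟫) =
      (∫ y, ⟪a n y, g' y⟫) - (∫ y, ⟪aL y, g' y⟫) + ((∫ y, ⟪a n y, ψ y⟫) - ∫ y, ⟪aL y, ψ y⟫) := by
    ring
  rw [e]
  calc |(∫ y, ⟪a n y, g' y⟫) - (∫ y, ⟪aL y, g' y⟫) + ((∫ y, ⟪a n y, ψ y⟫) - ∫ y, ⟪aL y, ψ y⟫)|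
      ≤ |(∫ y, ⟪a n y, g' y⟫) - (∫ y, ⟪aL y, g' y⟫)| + |(∫ y, ⟪a n y, ψ y⟫) - ∫ y, ⟪aL y, ψ y⟫| :=
        abs_add_le _ _
    _ ≤ (|∫ y, ⟪a n y, g' y⟫| + |∫ y, ⟪aL y, g' y⟫|) + |(∫ y, ⟪a n y, ψ y⟫) - ∫ y, ⟪aL y, ψ y⟫| := by
        gcongr; exact abs_sub _ _
    _ < ε / 3 + ε / 3 + ε / 3 := by linarith
    _ = ε := by ring

/-- `HolderConjugate 2 2` in `ℝ≥0∞`. [folklore] -/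
theorem holderConjugate_two_two : ENNReal.HolderConjugate (2 : ℝ≥0∞) 2 := by
  refine ⟨?_⟩
  rw [inv_one]
  exact ENNReal.inv_two_add_inv_two

/-- **The caloric extensions of a weakly convergent, uniformly locally bounded sequence converge
against test fields**: if the `a n ∈ L²(ℝ³)` and `aL ∈ L³(ℝ³)` have unit-ball energies `≤ A`
and `∫⟪a n, ψ⟫ → ∫⟪aL, ψ⟫` for all test fields `ψ`, then for `ν, t > 0` and every test field
`g`, `∫⟪W_{νt} * a n, g⟫ → ∫⟪W_{νt} * aL, g⟫` (symmetry of the heat semigroup and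
`tendsto_integral_inner_of_forall_ball_le` applied to the decaying smooth field `W_{νt} * g`).
[folklore] -/
theorem tendsto_integral_inner_heatTest_of_forall_ball_le
    {a : ℕ → EuclideanSpace ℝ (Fin 3) → EuclideanSpace ℝ (Fin 3)}
    {aL : EuclideanSpace ℝ (Fin 3) → EuclideanSpace ℝ (Fin 3)} {A : ℝ≥0∞} (hAtop : A ≠ ∞)
    (ha2 : ∀ n, MemLp (a n) 2 volume)
    (haA : ∀ n, ∀ z : EuclideanSpace ℝ (Fin 3), ∫⁻ y in ball z 1, ‖a n y‖ₑ ^ 2 ≤ A)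
    (haL : MemLp aL 3 volume)
    (haLA : ∀ z : EuclideanSpace ℝ (Fin 3), ∫⁻ y in ball z 1, ‖aL y‖ₑ ^ 2 ≤ A)
    (h : ∀ ψ : EuclideanSpace ℝ (Fin 3) → EuclideanSpace ℝ (Fin 3),
      FunctionSpaces.IsTestFunctionOn (⊤ : Opens (EuclideanSpace ℝ (Fin 3))) ψ →
        Tendsto (fun n => ∫ x, ⟪a n x, ψ x⟫) atTop (𝓝 (∫ x, ⟪aL x, ψ x⟫)))
    {ν t : ℝ} (hν : 0 < ν) (ht : 0 < t)
    {g : EuclideanSpace ℝ (Fin 3) → EuclideanSpace ℝ (Fin 3)}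
    (hg : FunctionSpaces.IsTestFunctionOn (⊤ : Opens (EuclideanSpace ℝ (Fin 3))) g) :
    Tendsto (fun n => ∫ x, ⟪heatTest ν (a n) t x, g x⟫) atTop
      (𝓝 (∫ x, ⟪heatTest ν aL t x, g x⟫)) := by
  haveI := holderConjugate_three_threeHalves
  haveI := holderConjugate_two_two
  have hνt : 0 < ν * t := mul_pos hν ht
  have hg2 : MemLp g 2 volume := hg.contDiff.continuous.memLp_of_hasCompactSupport hg.hasCompactSupport
  have hg32 : MemLp g (3 / 2 : ℝ≥0∞) volume :=
    hg.contDiff.continuous.memLp_of_hasCompactSupport hg.hasCompactSupport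
  have e : ∀ n, ∫ x, ⟪heatTest ν (a n) t x, g x⟫ =
      ∫ x, ⟪a n x, UnboundedOperators.heatExtension g (ν * t) x⟫ := fun n => by
    rw [heatTest_of_pos hν ht, ← integral_inner_heatExtension_comm (ha2 n) hg2 hνt]
  have eL : ∫ x, ⟪heatTest ν aL t x, g x⟫ = ∫ x, ⟪aL x, UnboundedOperators.heatExtension g (ν * t) x⟫ := by
    rw [heatTest_of_pos hν ht, ← integral_inner_heatExtension_comm haL hg32 hνt]
  simp_rw [e, eL]
  obtain ⟨B, -, hB⟩ := exists_norm_heatExtension_le_inv_one_add_pow hg.contDiff.continuous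
    hg.hasCompactSupport hνt
  have hsm : ContDiff ℝ (⊤ : ℕ∞) (UnboundedOperators.heatExtension g (ν * t)) := by
    have h1 := contDiff_heatTest hg ν t
    rwa [heatTest_of_pos hν ht] at h1
  exact tendsto_integral_inner_of_forall_ball_le hAtop (fun n => (ha2 n).aestronglyMeasurable) haA
    haL.aestronglyMeasurable haLA h hsm hB

/-! ### The every-time unit-ball bound from an a.e.-in-time one -/

/-- **The every-time unit-ball bound of a local energy solution from an a.e.-in-time bound**
(Seregin 2014, Def. B.1: (B.1.4) "at every time by (B.1.6)"): if
`∫_{B₁(x₀)} |v(s)|² ≤ C` for a.e. `s ∈ (0, T)` and all `x₀`, then the same holds for every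
`t ∈ [0, T]` — a full-measure set of times is dense in `[0, T]`, the pairings `∫⟪v(s), g⟫`
converge to `∫⟪v(t), g⟫` along it by weak continuity, and the `L²(B₁(x₀))` norm is lower
semicontinuous (duality, `eLpNorm_two_le_of_forall_isTestFunctionOn`). [cite: Seregin2014, Def. B.1 (B.1.4), (B.1.6)] -/
theorem _root_.Literature.Analysis.FluidPDE.IsLocalEnergySolutionOn.forall_lintegral_ball_le_of_ae
    {T ν : ℝ} {v₀ : EuclideanSpace ℝ (Fin 3) → EuclideanSpace ℝ (Fin 3)}
    {v : ℝ → EuclideanSpace ℝ (Fin 3) → EuclideanSpace ℝ (Fin 3)}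
    {π : ℝ → EuclideanSpace ℝ (Fin 3) → ℝ}
    (h : IsLocalEnergySolutionOn T ν v₀ v π) (hT : 0 < T) {C : ℝ≥0}
    (hC : ∀ᵐ t ∂(volume.restrict (Ioo 0 T)), ∀ x₀ : EuclideanSpace ℝ (Fin 3),
      ∫⁻ x in ball x₀ 1, ‖v t x‖ₑ ^ 2 ≤ C) :
    ∀ t ∈ Icc 0 T, ∀ x₀ : EuclideanSpace ℝ (Fin 3), ∫⁻ x in ball x₀ 1, ‖v t x‖ₑ ^ 2 ≤ C := by
  -- the good set of times is dense in `[0, T]`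
  set G : Set ℝ := {s | s ∈ Ioo (0 : ℝ) T ∧ ∀ x₀ : EuclideanSpace ℝ (Fin 3),
    ∫⁻ x in ball x₀ 1, ‖v s x‖ₑ ^ 2 ≤ C} with hG
  have hGsub : G ⊆ Icc 0 T := fun s hs => Ioo_subset_Icc_self hs.1
  have hae : ∀ᵐ t ∂volume, t ∈ Ioo (0 : ℝ) T → ∀ x₀ : EuclideanSpace ℝ (Fin 3),
      ∫⁻ x in ball x₀ 1, ‖v t x‖ₑ ^ 2 ≤ C := (ae_restrict_iff' measurableSet_Ioo).1 hC
  have hnull : volume {t | ¬ (t ∈ Ioo (0 : ℝ) T → ∀ x₀ : EuclideanSpace ℝ (Fin 3),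
      ∫⁻ x in ball x₀ 1, ‖v t x‖ₑ ^ 2 ≤ C)} = 0 := ae_iff.1 hae
  have hclos : Ioo (0 : ℝ) T ⊆ closure G := by
    intro s hs
    rw [_root_.mem_closure_iff]
    intro o ho hso
    by_contra hemp
    rw [not_nonempty_iff_eq_empty] at hemp
    have hU : IsOpen (o ∩ Ioo 0 T) := ho.inter isOpen_Ioo
    have hpos : 0 < volume (o ∩ Ioo (0 : ℝ) T) := hU.measure_pos volume ⟨s, hso, hs⟩
    have hsub : o ∩ Ioo (0 : ℝ) T ⊆ {t | ¬ (t ∈ Ioo (0 : ℝ) T → ∀ x₀ : EuclideanSpace ℝ (Fin 3),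
        ∫⁻ x in ball x₀ 1, ‖v t x‖ₑ ^ 2 ≤ C)} := by
      intro t ht hP
      have : t ∈ o ∩ G := ⟨ht.1, ht.2, hP ht.2⟩
      rw [hemp] at this
      exact this
    exact absurd (measure_mono_null hsub hnull) hpos.ne'
  have hIcc : Icc (0 : ℝ) T ⊆ closure G := by
    rw [← closure_Ioo hT.ne]
    exact closure_minimal hclos isClosed_closure
  intro t ht x₀
  haveI : (𝓝[G] t).NeBot := mem_closure_iff_nhdsWithin_neBot.1 (hIcc ht)
  set S : Opens (EuclideanSpace ℝ (Fin 3)) := ⟨ball x₀ 1, isOpen_ball⟩ with hS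
  have hmem : MemLp (v t) 2 (volume.restrict (S : Set (EuclideanSpace ℝ (Fin 3)))) := h.memLp_two_ball ht x₀
  set K : ℝ≥0∞ := (C : ℝ≥0∞) ^ (1 / 2 : ℝ) with hK
  have hKtop : K ≠ ∞ := ENNReal.rpow_ne_top_of_nonneg (by norm_num) ENNReal.coe_ne_top
  have hdual : eLpNorm (v t) 2 (volume.restrict (S : Set (EuclideanSpace ℝ (Fin 3)))) ≤
      ENNReal.ofReal K.toReal := by
    refine eLpNorm_two_le_of_forall_isTestFunctionOn S hmem ENNReal.toReal_nonneg fun g hg => ?_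
    have hgtop : FunctionSpaces.IsTestFunctionOn (⊤ : Opens (EuclideanSpace ℝ (Fin 3))) g :=
      hg.mono le_top
    have hg2 : MemLp g 2 (volume.restrict (S : Set (EuclideanSpace ℝ (Fin 3)))) :=
      (hg.contDiff.continuous.memLp_of_hasCompactSupport hg.hasCompactSupport).restrict _
    have hsupp : tsupport g ⊆ ball x₀ 1 := hg.tsupport_subset
    have hlim : Tendsto (fun s => ∫ x, ⟪v s x, g x⟫) (𝓝[G] t) (𝓝 (∫ x, ⟪v t x, g x⟫)) :=
      ((h.weakContinuous g hgtop) t ht).tendsto.mono_left (nhdsWithin_mono _ hGsub)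
    have hbd : ∀ s ∈ G, |∫ x, ⟪v s x, g x⟫| ≤
        K.toReal * (eLpNorm g 2 (volume.restrict (S : Set (EuclideanSpace ℝ (Fin 3))))).toReal := by
      intro s hs
      have hmems : MemLp (v s) 2 (volume.restrict (S : Set (EuclideanSpace ℝ (Fin 3)))) :=
        h.memLp_two_ball (hGsub hs) x₀
      rw [integral_inner_eq_setIntegral_of_tsupport_subset _ hsupp]
      refine (FunctionSpaces.abs_integral_inner_le_eLpNorm_two_mul hmems hg2).trans ?_
      refine mul_le_mul_of_nonneg_right (ENNReal.toReal_mono hKtop ?_) ENNReal.toReal_nonneg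
      exact eLpNorm_two_le_rpow_of_lintegral_sq_le (hs.2 x₀)
    exact le_of_tendsto ((continuous_abs.tendsto _).comp hlim) (eventually_nhdsWithin_of_forall hbd)
  calc ∫⁻ x in ball x₀ 1, ‖v t x‖ₑ ^ 2
      = eLpNorm (v t) 2 (volume.restrict (S : Set (EuclideanSpace ℝ (Fin 3)))) ^ 2 :=
        lintegral_enorm_sq_eq_eLpNorm_two_pow _ _
    _ ≤ (ENNReal.ofReal K.toReal) ^ 2 := by gcongr
    _ = (C : ℝ≥0∞) := by
        rw [ENNReal.ofReal_toReal hKtop, hK, ← ENNReal.rpow_natCast, ← ENNReal.rpow_mul]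
        norm_num

/-! ### The initial layer passes to the limit (uniformly local version) -/

/-- **The uniform initial layer passes to the weak limit**, uniformly local version of the
tree's `eLpNorm_sub_heatTest_le_of_tendsto` (Lemarié-Rieusset 2016, p. 571): the data `a n` are
in `L²(ℝ³)` with unit-ball energies `≤ A`, the limit datum `aL ∈ L³(ℝ³)` has unit-ball energies
`≤ A`; if `‖w n − W_{νt} * a n‖_{L²(B(x₀,1))} ≤ B` for all `n` and `a n → aL`, `w n → wL`
against test fields, then `‖wL − W_{νt} * aL‖_{L²(B(x₀,1))} ≤ B`. [cite: LemarieRieusset2016, proof of Thm. 15.5, p. 571] -/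
theorem eLpNorm_sub_heatTest_le_of_tendsto' {ν t : ℝ} (hν : 0 < ν) (ht : 0 < t) {A : ℝ≥0∞}
    (hAtop : A ≠ ∞) {B : ℝ≥0}
    {a : ℕ → EuclideanSpace ℝ (Fin 3) → EuclideanSpace ℝ (Fin 3)}
    {aL : EuclideanSpace ℝ (Fin 3) → EuclideanSpace ℝ (Fin 3)}
    {w : ℕ → EuclideanSpace ℝ (Fin 3) → EuclideanSpace ℝ (Fin 3)}
    {wL : EuclideanSpace ℝ (Fin 3) → EuclideanSpace ℝ (Fin 3)}
    (ha2 : ∀ n, MemLp (a n) 2 volume)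
    (haA : ∀ n, ∀ z : EuclideanSpace ℝ (Fin 3), ∫⁻ y in ball z 1, ‖a n y‖ₑ ^ 2 ≤ A)
    (haL : MemLp aL 3 volume)
    (haLA : ∀ z : EuclideanSpace ℝ (Fin 3), ∫⁻ y in ball z 1, ‖aL y‖ₑ ^ 2 ≤ A)
    (hconv0 : ∀ ψ : EuclideanSpace ℝ (Fin 3) → EuclideanSpace ℝ (Fin 3),
      FunctionSpaces.IsTestFunctionOn (⊤ : Opens (EuclideanSpace ℝ (Fin 3))) ψ →
        Tendsto (fun n => ∫ x, ⟪a n x, ψ x⟫) atTop (𝓝 (∫ x, ⟪aL x, ψ x⟫)))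
    (hconv : ∀ ψ : EuclideanSpace ℝ (Fin 3) → EuclideanSpace ℝ (Fin 3),
      FunctionSpaces.IsTestFunctionOn (⊤ : Opens (EuclideanSpace ℝ (Fin 3))) ψ →
        Tendsto (fun n => ∫ x, ⟪w n x, ψ x⟫) atTop (𝓝 (∫ x, ⟪wL x, ψ x⟫)))
    (x₀ : EuclideanSpace ℝ (Fin 3))
    (hw2 : ∀ n, MemLp (w n) 2 (volume.restrict (ball x₀ 1)))
    (hwL2 : MemLp wL 2 (volume.restrict (ball x₀ 1)))
    (hlayer : ∀ n, eLpNorm (w n - heatTest ν (a n) t) 2 (volume.restrict (ball x₀ 1)) ≤ B) :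
    eLpNorm (wL - heatTest ν aL t) 2 (volume.restrict (ball x₀ 1)) ≤ B := by
  set S : Opens (EuclideanSpace ℝ (Fin 3)) := ⟨ball x₀ 1, isOpen_ball⟩ with hS
  set μB : Measure (EuclideanSpace ℝ (Fin 3)) := volume.restrict (ball x₀ 1) with hμB
  -- the caloric extensions, in `L²` of the ball
  have hWn : ∀ n, MemLp (heatTest ν (a n) t) 2 μB := fun n =>
    (memLp_heatFlow_holds (ha2 n) (by norm_num) (mul_nonneg hν.le ht.le) :
      MemLp (heatTest ν (a n) t) 2 volume).restrict _
  have hWL : MemLp (heatTest ν aL t) 2 μB := (memLp_two_heatTest_restrict_ball hν ht.le haL x₀).2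
  have hfL : MemLp (wL - heatTest ν aL t) 2 μB := hwL2.sub hWL
  rw [← ENNReal.ofReal_coe_nnreal]
  refine eLpNorm_two_le_of_forall_isTestFunctionOn S hfL B.coe_nonneg fun g hg => ?_
  have hgtop : FunctionSpaces.IsTestFunctionOn (⊤ : Opens (EuclideanSpace ℝ (Fin 3))) g := hg.mono le_top
  have hg2 : MemLp g 2 μB :=
    (hg.contDiff.continuous.memLp_of_hasCompactSupport hg.hasCompactSupport).restrict _
  have hsupp : tsupport g ⊆ ball x₀ 1 := hg.tsupport_subset
  -- the pairing of a difference, as a ball integral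
  have hpair : ∀ {f₁ f₂ : EuclideanSpace ℝ (Fin 3) → EuclideanSpace ℝ (Fin 3)}, MemLp f₁ 2 μB →
      MemLp f₂ 2 μB → ∫ x, ⟪(f₁ - f₂) x, g x⟫ = (∫ x, ⟪f₁ x, g x⟫) - ∫ x, ⟪f₂ x, g x⟫ := by
    intro f₁ f₂ h₁ h₂
    rw [integral_inner_eq_setIntegral_of_tsupport_subset _ hsupp,
      integral_inner_eq_setIntegral_of_tsupport_subset _ hsupp,
      integral_inner_eq_setIntegral_of_tsupport_subset _ hsupp,
      ← integral_sub (integrable_inner_of_memLp_conj h₁ hg2) (integrable_inner_of_memLp_conj h₂ hg2)]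
    refine integral_congr_ae (Eventually.of_forall fun x => ?_)
    simp only [Pi.sub_apply, inner_sub_left]
  -- the approximating pairings are bounded by `B ‖g‖`
  have hbd : ∀ n, |∫ x, ⟪(w n - heatTest ν (a n) t) x, g x⟫| ≤ (B : ℝ) * (eLpNorm g 2 μB).toReal := by
    intro n
    rw [integral_inner_eq_setIntegral_of_tsupport_subset _ hsupp]
    refine (FunctionSpaces.abs_integral_inner_le_eLpNorm_two_mul ((hw2 n).sub (hWn n)) hg2).trans ?_
    refine mul_le_mul_of_nonneg_right ?_ ENNReal.toReal_nonneg
    have := ENNReal.toReal_mono ENNReal.coe_ne_top (hlayer n)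
    rwa [ENNReal.coe_toReal] at this
  -- and converge to the limit pairing
  have hlim : Tendsto (fun n => ∫ x, ⟪(w n - heatTest ν (a n) t) x, g x⟫) atTop
      (𝓝 (∫ x, ⟪(wL - heatTest ν aL t) x, g x⟫)) := by
    have e : (fun n => ∫ x, ⟪(w n - heatTest ν (a n) t) x, g x⟫) =
        fun n => (∫ x, ⟪w n x, g x⟫) - ∫ x, ⟪heatTest ν (a n) t x, g x⟫ :=
      funext fun n => hpair (hw2 n) (hWn n)
    rw [e, hpair hwL2 hWL]
    exact (hconv g hgtop).sub
      (tendsto_integral_inner_heatTest_of_forall_ball_le hAtop ha2 haA haL haLA hconv0 hν ht hgtop)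
  exact le_of_tendsto ((continuous_abs.tendsto _).comp hlim) (Eventually.of_forall hbd)

/-! ### The extraction theorem -/

/-- **Extraction of the limit local energy solution** (the limiting procedure of the
compactness proof of Barker–Prange's Theorem 2; Seregin 2014, Ch. 7 §7.3 and App. B §B.4;
Lemarié-Rieusset 2016, pp. 570–571). `hLayer` (inline hypothesis, proved in the sequel files)
is the uniform local initial layer near the origin, assumed for `L³`-smallness levels
`γ ≤ γ₁` only (the level of the sequence is `γ ≤ γ₁`). Given `M, γ > 0` there is `σ₀ ∈ (0, 1)`
(the time of Jia–Šverák's a priori estimate for unit-ball energies `M²`) such that for every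
`σ ∈ (0, σ₀]` and every sequence of unit-viscosity local energy solutions `(v₀ⁿ, vⁿ, πⁿ)` on
`ℝ³ × (0, σ)` with data in `L²(ℝ³)`, `‖v₀ⁿ‖_{L²(B₁(x̄))} ≤ M`, `‖v₀ⁿ‖_{L³(B(0, Rₙ))} ≤ γ`,
`Rₙ → ∞`: the unit-ball energies and unit-cylinder dissipations of all `vⁿ` are bounded by one
constant `C` (a priori estimate, every time by weak continuity), and a subsequence converges in
`L²((0, σ) × B_R)` for every `R` to a local energy solution `(u, p)` on `ℝ³ × (0, σ)` whose datum
`aL = u(0)` lies in `L³(ℝ³)` with `‖aL‖₃ ≤ γ` (the `L³` bound from the local ones: every test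
field is eventually supported in `B(0, Rₙ)`; weak divergence-freeness, the initial layer —
hence the initial condition —, weak continuity, the local pressure expansion and the decay at
infinity pass to the limit as in `lemarieRieusset_localLeray_compactness_of_parts`, the caloric
extensions converging by `tendsto_integral_inner_heatTest_of_forall_ball_le`).
[cite: Seregin2014, Ch. 7 §7.3 (7.3.2)–(7.3.12) and App. B §B.4] [cite: LemarieRieusset2016, proof of Thm. 15.5, pp. 570–571] -/
theorem exists_limit_localEnergySolution_of_le {γ₁ : ℝ}
    (hLayer : ∀ (T : ℝ) (A P γ : ℝ≥0), 0 < T → T ≤ 1 → (γ : ℝ) ≤ γ₁ →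
      ∃ η : ℝ → ℝ≥0, Tendsto η (𝓝[>] 0) (𝓝 0) ∧
        ∀ (R : ℝ) (v₀ : EuclideanSpace ℝ (Fin 3) → EuclideanSpace ℝ (Fin 3))
          (v : ℝ → EuclideanSpace ℝ (Fin 3) → EuclideanSpace ℝ (Fin 3))
          (π : ℝ → EuclideanSpace ℝ (Fin 3) → ℝ)
          (G : ℝ → EuclideanSpace ℝ (Fin 3) → EuclideanSpace ℝ (Fin 3) →L[ℝ] EuclideanSpace ℝ (Fin 3)),
          IsLocalEnergySolutionOn T 1 v₀ v π → MemLp v₀ 2 volume →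
          eLpNorm v₀ 3 (volume.restrict (ball (0 : EuclideanSpace ℝ (Fin 3)) R)) ≤ γ →
          (∀ t ∈ Icc 0 T, ∀ x₀ : EuclideanSpace ℝ (Fin 3), ∫⁻ x in ball x₀ 1, ‖v t x‖ₑ ^ 2 ≤ A) →
          HasWeakSpatialGradientOn (slab (EuclideanSpace ℝ (Fin 3)) (Ioo 0 T) isOpen_Ioo) v G →
          (∀ x₀ : EuclideanSpace ℝ (Fin 3), ∫⁻ z in Ioo 0 T ×ˢ ball x₀ 1,
            ENNReal.ofReal (frobeniusNormSq (G z.1 z.2)) ≤ A) →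
          (∀ x₀ : EuclideanSpace ℝ (Fin 3), ∃ c : ℝ → ℝ,
            MemLp c (3 / 2 : ℝ≥0∞) (volume.restrict (Ioo 0 T)) ∧
            ∫⁻ z in Ioo 0 T ×ˢ ball x₀ 3, ‖π z.1 z.2 - c z.1‖ₑ ^ (3 / 2 : ℝ) ≤ P) →
          ∀ x₀ : EuclideanSpace ℝ (Fin 3), ‖x₀‖ + 8 ≤ R → ∀ t ∈ Ioo 0 T,
            eLpNorm (v t - heatTest 1 v₀ t) 2 (volume.restrict (ball x₀ 1)) ≤ η t)
    {M γ : ℝ} (hM : 0 < M) (hγ : 0 < γ) (hγ₁ : γ ≤ γ₁) :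
    ∃ σ₀ : ℝ, 0 < σ₀ ∧ σ₀ < 1 ∧ ∀ σ : ℝ, 0 < σ → σ ≤ σ₀ →
      ∀ (R : ℕ → ℝ) (v₀ : ℕ → EuclideanSpace ℝ (Fin 3) → EuclideanSpace ℝ (Fin 3))
        (v : ℕ → ℝ → EuclideanSpace ℝ (Fin 3) → EuclideanSpace ℝ (Fin 3))
        (π : ℕ → ℝ → EuclideanSpace ℝ (Fin 3) → ℝ),
        Tendsto R atTop atTop →
        (∀ n, IsLocalEnergySolutionOn σ 1 (v₀ n) (v n) (π n)) →
        (∀ n, MemLp (v₀ n) 2 volume) →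
        (∀ n, ∀ x₁ : EuclideanSpace ℝ (Fin 3),
          eLpNorm (v₀ n) 2 (volume.restrict (ball x₁ 1)) ≤ ENNReal.ofReal M) →
        (∀ n, eLpNorm (v₀ n) 3 (volume.restrict (ball (0 : EuclideanSpace ℝ (Fin 3)) (R n))) ≤
          ENNReal.ofReal γ) →
        ∃ (C : ℝ≥0) (φ : ℕ → ℕ) (aL : EuclideanSpace ℝ (Fin 3) → EuclideanSpace ℝ (Fin 3))
          (u : ℝ → EuclideanSpace ℝ (Fin 3) → EuclideanSpace ℝ (Fin 3))
          (p : ℝ → EuclideanSpace ℝ (Fin 3) → ℝ),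
          StrictMono φ ∧ IsLocalEnergySolutionOn σ 1 aL u p ∧ MemLp aL 3 volume ∧
          eLpNorm aL 3 volume ≤ ENNReal.ofReal γ ∧
          (∀ n, ∀ᵐ t ∂(volume.restrict (Ioo 0 σ)), ∀ x₀ : EuclideanSpace ℝ (Fin 3),
            ∫⁻ x in ball x₀ 1, ‖v n t x‖ₑ ^ 2 ≤ C) ∧
          (∀ n, ∃ G : ℝ → EuclideanSpace ℝ (Fin 3) → EuclideanSpace ℝ (Fin 3) →L[ℝ] EuclideanSpace ℝ (Fin 3),
            HasWeakSpatialGradientOn (slab (EuclideanSpace ℝ (Fin 3)) (Ioo 0 σ) isOpen_Ioo) (v n) G ∧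
              ∀ x₀ : EuclideanSpace ℝ (Fin 3), ∫⁻ z in Ioo 0 σ ×ˢ ball x₀ 1,
                ENNReal.ofReal (frobeniusNormSq (G z.1 z.2)) ≤ C) ∧
          ∀ Rb : ℝ, 0 < Rb →
            Tendsto (fun k => ∫⁻ z in Ioo 0 σ ×ˢ ball (0 : EuclideanSpace ℝ (Fin 3)) Rb,
              ‖v (φ k) z.1 z.2 - u z.1 z.2‖ₑ ^ 2) atTop (𝓝 0) := by
  -- ### the absolute constants of the a priori estimate and the time `σ₀`
  obtain ⟨ε₀, hε₀, hε₀1, C, hAP⟩ := JiaSverak2014.apriori_unit_scale_slab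
  have hε₀' : (0 : ℝ) < ε₀ := by exact_mod_cast hε₀
  set α : ℝ≥0 := (M ^ 2 / 2).toNNReal with hα
  have hα_coe : (α : ℝ) = M ^ 2 / 2 := Real.coe_toNNReal _ (by positivity)
  have h2α : 2 * (α : ℝ≥0∞) = ENNReal.ofReal (M ^ 2) := by
    rw [show (α : ℝ≥0∞) = ENNReal.ofReal (M ^ 2 / 2) from rfl, ← ENNReal.ofReal_ofNat 2,
      ← ENNReal.ofReal_mul (by norm_num)]
    congr 1; ring
  set σ₀ : ℝ := min (1 / 2) (min ε₀ (ε₀ / ((α : ℝ) ^ 2 + 1))) with hσ₀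
  have hσ₀pos : 0 < σ₀ := lt_min (by norm_num) (lt_min hε₀' (by positivity))
  refine ⟨σ₀, hσ₀pos, (min_le_left _ _).trans_lt (by norm_num), ?_⟩
  intro σ hσ hσσ₀ R v₀ v π hR hv hv2 hvM hvL3
  have hσ1 : σ ≤ 1 := hσσ₀.trans ((min_le_left _ _).trans (by norm_num))
  have hσε : σ ≤ ε₀ := hσσ₀.trans ((min_le_right _ _).trans (min_le_left _ _))
  have hσα : σ * (α : ℝ) ^ 2 ≤ (ε₀ : ℝ) := by
    have h1 : σ ≤ (ε₀ : ℝ) / ((α : ℝ) ^ 2 + 1) :=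
      hσσ₀.trans ((min_le_right _ _).trans (min_le_right _ _))
    have h2 : (α : ℝ) ^ 2 ≤ (α : ℝ) ^ 2 + 1 := by linarith
    calc σ * (α : ℝ) ^ 2 ≤ (ε₀ : ℝ) / ((α : ℝ) ^ 2 + 1) * ((α : ℝ) ^ 2 + 1) :=
          mul_le_mul h1 h2 (by positivity) (by positivity)
      _ = (ε₀ : ℝ) := by field_simp
  -- ### uniform bounds on `(0, σ)` (a priori estimate; every time by weak continuity)
  have hGex : ∀ n, ∃ G : ℝ → EuclideanSpace ℝ (Fin 3) → EuclideanSpace ℝ (Fin 3) →L[ℝ] EuclideanSpace ℝ (Fin 3),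
      HasWeakSpatialGradientOn (slab (EuclideanSpace ℝ (Fin 3)) (Ioo 0 σ) isOpen_Ioo) (v n) G :=
    fun n => (hv n).exists_hasWeakSpatialGradientOn
  choose G hG using hGex
  have hdat : ∀ n, ∀ x₁ : EuclideanSpace ℝ (Fin 3),
      ∫⁻ x in ball x₁ 1, ‖v₀ n x‖ₑ ^ 2 ≤ 2 * (α : ℝ≥0∞) := fun n x₁ => by
    rw [h2α, lintegral_enorm_sq_eq_eLpNorm_two_pow, ENNReal.ofReal_pow hM.le]
    exact pow_le_pow_left' (hvM n x₁) 2
  have hAPn := fun n => hAP (v₀ n) (v n) (π n) (G n) α σ σ (hv2 n).aestronglyMeasurable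
    (hv n).isLocalLeraySolutionOn (hG n) (hdat n) hσ le_rfl hσε hσα
  set Cb : ℝ≥0 := 2 * (C * α) with hCb
  have hCbE : (2 * ((C * α : ℝ≥0) : ℝ≥0∞)) = (Cb : ℝ≥0∞) := by rw [hCb]; push_cast; ring
  have hE : ∀ n, ∀ᵐ t ∂(volume.restrict (Ioo (0 : ℝ) σ)), ∀ x₀ : EuclideanSpace ℝ (Fin 3),
      ∫⁻ x in ball x₀ 1, ‖v n t x‖ₑ ^ 2 ≤ Cb := fun n =>
    ((hAPn n).1).mono fun t ht x₀ => (ht x₀).trans hCbE.le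
  have hD : ∀ n, ∀ x₀ : EuclideanSpace ℝ (Fin 3), ∫⁻ z in Ioo (0 : ℝ) σ ×ˢ ball x₀ 1,
      ENNReal.ofReal (frobeniusNormSq (G n z.1 z.2)) ≤ Cb := fun n x₀ =>
    ((hAPn n).2.1 x₀).trans (by
      rw [← hCbE]; exact le_mul_of_one_le_left bot_le one_le_two)
  have hEt : ∀ n, ∀ t ∈ Icc 0 σ, ∀ x₀ : EuclideanSpace ℝ (Fin 3),
      ∫⁻ x in ball x₀ 1, ‖v n t x‖ₑ ^ 2 ≤ Cb := fun n =>
    (hv n).forall_lintegral_ball_le_of_ae hσ (hE n)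
  have hGb : ∀ n, ∃ G : ℝ → EuclideanSpace ℝ (Fin 3) → EuclideanSpace ℝ (Fin 3) →L[ℝ] EuclideanSpace ℝ (Fin 3),
      HasWeakSpatialGradientOn (slab (EuclideanSpace ℝ (Fin 3)) (Ioo 0 σ) isOpen_Ioo) (v n) G ∧
        ∀ x₀ : EuclideanSpace ℝ (Fin 3), ∫⁻ z in Ioo 0 σ ×ˢ ball x₀ 1,
          ENNReal.ofReal (frobeniusNormSq (G z.1 z.2)) ≤ Cb := fun n => ⟨G n, hG n, hD n⟩
  -- ### the gauged pressures at radius `3` (Kang–Miura–Tsai)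
  set Ak : ℝ≥0 := 2 * α + Cb with hAk
  have hαAk : 2 * (α : ℝ≥0∞) ≤ Ak := by rw [hAk]; push_cast; exact le_self_add
  have hCbAk : (Cb : ℝ≥0∞) ≤ Ak := by rw [hAk]; push_cast; exact le_add_self
  obtain ⟨Kp, hKp⟩ := kangMiuraTsai_local_pressure_bound_holds σ 3 Ak hσ (by norm_num)
  have hPress : ∀ n, ∀ x₀ : EuclideanSpace ℝ (Fin 3), ∃ c : ℝ → ℝ,
      MemLp c (3 / 2 : ℝ≥0∞) (volume.restrict (Ioo 0 σ)) ∧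
        ∫⁻ z in Ioo 0 σ ×ˢ ball x₀ 3, ‖π n z.1 z.2 - c z.1‖ₑ ^ (3 / 2 : ℝ) ≤ Kp := fun n =>
    hKp (v₀ n) (v n) (π n) (hv n).isLocalLeraySolutionOn (fun x₀ => (hdat n x₀).trans hαAk)
      ((hv n).isWeaklyDivFree_datum hσ) ((hE n).mono fun t ht x₀ => (ht x₀).trans hCbAk)
      ⟨G n, hG n, fun x₀ => (hD n x₀).trans hCbAk⟩
  -- ### the layer function
  set γn : ℝ≥0 := γ.toNNReal with hγn
  have hγnE : ENNReal.ofReal γ = (γn : ℝ≥0∞) := rfl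
  have hγn_coe : (γn : ℝ) = γ := Real.coe_toNNReal _ hγ.le
  obtain ⟨η, hη, hL⟩ := hLayer σ Cb Kp γn hσ hσ1 (by rw [hγn_coe]; exact hγ₁)
  -- ### F1: the limiting procedure on `[0, σ]`
  obtain ⟨φ, u, p, c, hφ, hc, hsuit, hp, hmeas, huC, huG, hL2, hL3, hunif, hpress⟩ :=
    seregin2014_localEnergy_limitingProcedure_holds one_pos hσ Cb v₀ v π hv hEt hGb
  have hpt : ∀ t ∈ Icc 0 σ, ∀ ψ : EuclideanSpace ℝ (Fin 3) → EuclideanSpace ℝ (Fin 3),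
      FunctionSpaces.IsTestFunctionOn (⊤ : Opens (EuclideanSpace ℝ (Fin 3))) ψ →
        Tendsto (fun k => ∫ x, ⟪v (φ k) t x, ψ x⟫) atTop (𝓝 (∫ x, ⟪u t x, ψ x⟫)) :=
    fun t ht ψ hψ => (hunif ψ hψ).tendsto_at ht
  have hRφ : Tendsto (fun k => R (φ k)) atTop atTop := hR.comp hφ.tendsto_atTop
  -- ### the datum of the limit, `aL = u(0)`; it is `γ`-small in `L³(ℝ³)`
  set aL : EuclideanSpace ℝ (Fin 3) → EuclideanSpace ℝ (Fin 3) := u 0 with haL_def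
  have h0 : (0 : ℝ) ∈ Icc 0 σ := ⟨le_rfl, hσ.le⟩
  have hconv0 : ∀ ψ : EuclideanSpace ℝ (Fin 3) → EuclideanSpace ℝ (Fin 3),
      FunctionSpaces.IsTestFunctionOn (⊤ : Opens (EuclideanSpace ℝ (Fin 3))) ψ →
        Tendsto (fun k => ∫ x, ⟪v₀ (φ k) x, ψ x⟫) atTop (𝓝 (∫ x, ⟪aL x, ψ x⟫)) := by
    intro ψ hψ
    have e : ∀ k, ∫ x, ⟪v₀ (φ k) x, ψ x⟫ = ∫ x, ⟪v (φ k) 0 x, ψ x⟫ := fun k =>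
      ((hv (φ k)).integral_inner_zero_eq hσ ((hv2 (φ k)).locallyIntegrable (by norm_num)) hψ).symm
    simp_rw [e]
    exact hpt 0 h0 ψ hψ
  haveI := holderConjugate_three_threeHalves
  have haL : MemLp aL 3 volume ∧ eLpNorm aL 3 volume ≤ ENNReal.ofReal γ := by
    refine FunctionSpaces.memLp_three_of_forall_abs_integral_inner_le (hmeas 0 h0)
      (locallyIntegrable_norm_sq_of_forall_ball_le (hmeas 0 h0) ENNReal.coe_ne_top (huC 0 h0))
      hγ.le fun ψ hψ => ?_
    have hψq : MemLp ψ (3 / 2 : ℝ≥0∞) volume :=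
      hψ.contDiff.continuous.memLp_of_hasCompactSupport hψ.hasCompactSupport
    -- the support of `ψ` lies in `B(0, R (φ k))` eventually
    obtain ⟨ρ, hρ⟩ := hψ.hasCompactSupport.isCompact.isBounded.subset_closedBall (0 : EuclideanSpace ℝ (Fin 3))
    have hev : ∀ᶠ k in atTop, |∫ x, ⟪v₀ (φ k) x, ψ x⟫| ≤ γ * (eLpNorm ψ (3 / 2 : ℝ≥0∞) volume).toReal := by
      filter_upwards [tendsto_atTop.1 hRφ (ρ + 1)] with k hk
      set S : Set (EuclideanSpace ℝ (Fin 3)) := ball (0 : EuclideanSpace ℝ (Fin 3)) (R (φ k)) with hS_def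
      have hsuppS : tsupport ψ ⊆ S := hρ.trans (closedBall_subset_ball (by linarith))
      set fS : EuclideanSpace ℝ (Fin 3) → EuclideanSpace ℝ (Fin 3) := S.indicator (v₀ (φ k)) with hfS
      have hfS3 : MemLp fS 3 volume := by
        rw [hfS, memLp_indicator_iff_restrict measurableSet_ball]
        exact ⟨(hv2 (φ k)).aestronglyMeasurable.restrict,
          (hvL3 (φ k)).trans_lt ENNReal.ofReal_lt_top⟩
      have hnorm : eLpNorm fS 3 volume ≤ ENNReal.ofReal γ := by
        rw [hfS, eLpNorm_indicator_eq_eLpNorm_restrict measurableSet_ball]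
        exact hvL3 (φ k)
      have heq : ∫ x, ⟪v₀ (φ k) x, ψ x⟫ = ∫ x, ⟪fS x, ψ x⟫ := by
        refine integral_congr_ae (Eventually.of_forall fun x => ?_)
        show ⟪v₀ (φ k) x, ψ x⟫ = ⟪fS x, ψ x⟫
        by_cases hx : x ∈ S
        · rw [hfS, indicator_of_mem hx]
        · have hψ0 : ψ x = 0 := image_eq_zero_of_notMem_tsupport fun h' => hx (hsuppS h')
          rw [hψ0, inner_zero_right, inner_zero_right]
      rw [heq]
      refine (abs_integral_inner_le_eLpNorm_three_mul hfS3 hψq).trans ?_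
      exact mul_le_mul_of_nonneg_right (ENNReal.toReal_le_of_le_ofReal hγ.le hnorm) ENNReal.toReal_nonneg
    exact le_of_tendsto ((continuous_abs.tendsto _).comp (hconv0 ψ hψ)) hev
  have haLdiv : IsWeaklyDivFree aL :=
    IsWeaklyDivFree.of_tendsto_integral_inner (fun k => (hv (φ k)).isWeaklyDivFree_datum hσ) hconv0
  -- ### the initial layer of the limit: `‖u(t) − W_t aL‖_{L²(B(x₀,1))} ≤ η(t)`
  have hAk_top : ((Ak : ℝ≥0) : ℝ≥0∞) ≠ ∞ := ENNReal.coe_ne_top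
  have hlayerL : ∀ t ∈ Ioo 0 σ, ∀ x₀ : EuclideanSpace ℝ (Fin 3),
      eLpNorm (u t - heatTest 1 aL t) 2 (volume.restrict (ball x₀ 1)) ≤ η t := by
    intro t ht x₀
    have htI : t ∈ Icc 0 σ := ⟨ht.1.le, ht.2.le⟩
    -- eventually the layer of the approximants holds at `x₀`
    obtain ⟨K₀, hK₀⟩ := (tendsto_atTop.1 hRφ (‖x₀‖ + 8)).exists_forall_of_atTop
    refine eLpNorm_sub_heatTest_le_of_tendsto' one_pos ht.1 hAk_top
      (a := fun k => v₀ (φ (k + K₀))) (w := fun k => v (φ (k + K₀)) t)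
      (fun k => hv2 _) (fun k z => (hdat _ z).trans hαAk) haL.1
      (fun z => (huC 0 h0 z).trans hCbAk)
      (fun ψ hψ => (hconv0 ψ hψ).comp (tendsto_add_atTop_nat K₀))
      (fun ψ hψ => (hpt t htI ψ hψ).comp (tendsto_add_atTop_nat K₀)) x₀
      (fun k => (hv _).memLp_two_ball htI x₀)
      (memLp_two_restrict_ball_of_lintegral_le (hmeas t htI) x₀ (huC t htI x₀)) fun k => ?_
    exact hL (R (φ (k + K₀))) (v₀ (φ (k + K₀))) (v (φ (k + K₀))) (π (φ (k + K₀))) (G (φ (k + K₀)))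
      (hv _) (hv2 _) (by rw [← hγnE]; exact hvL3 _) (hEt _) (hG _) (hD _) (hPress _) x₀
      (hK₀ (k + K₀) (Nat.le_add_left _ _)) t ht
  have hinit : ∀ K : Set (EuclideanSpace ℝ (Fin 3)), IsCompact K →
      Tendsto (fun t => ∫⁻ x in K, ‖u t x - aL x‖ₑ ^ 2) (𝓝[>] 0) (𝓝 0) := fun K hK =>
    tendsto_lintegral_sub_datum_of_layer one_pos hσ hη haL.1 (fun t ht => hmeas t ⟨ht.1.le, ht.2.le⟩)
      hlayerL hK
  -- ### weak continuity of the limit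
  have hwc : ∀ ψ : EuclideanSpace ℝ (Fin 3) → EuclideanSpace ℝ (Fin 3),
      FunctionSpaces.IsTestFunctionOn (⊤ : Opens (EuclideanSpace ℝ (Fin 3))) ψ →
        ContinuousOn (fun t => ∫ x, ⟪u t x, ψ x⟫) (Icc 0 σ) := fun ψ hψ =>
    (hunif ψ hψ).continuousOn (Frequently.of_forall fun k => (hv (φ k)).weakContinuous ψ hψ)
  -- ### the local pressure expansion of the limit, and its decay at spatial infinity (F2)
  set w : ℕ → ℝ → EuclideanSpace ℝ (Fin 3) → EuclideanSpace ℝ (Fin 3) := fun k => v (φ k) with hw_def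
  set q : ℕ → ℝ → EuclideanSpace ℝ (Fin 3) → ℝ := fun k t x => π (φ k) t x - c k t with hq_def
  have hw : ∀ k, IsLocalLeraySolutionOn σ 1 (v₀ (φ k)) (w k) (q k) := fun k =>
    (hv (φ k)).isLocalLeraySolutionOn_sub_gauge (hc k).1 (hc k).2
  have hwC : ∀ k, ∀ᵐ t ∂(volume.restrict (Ioo (0 : ℝ) σ)),
      ∀ x₀ : EuclideanSpace ℝ (Fin 3), ∫⁻ y in ball x₀ 1, ‖w k t y‖ₑ ^ 2 ≤ Cb := fun k =>
    (ae_restrict_mem measurableSet_Ioo).mono fun t ht x₀ => hEt (φ k) t ⟨ht.1.le, ht.2.le⟩ x₀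
  have huA : ∀ᵐ t ∂(volume.restrict (Ioo (0 : ℝ) σ)),
      ∀ x₀ : EuclideanSpace ℝ (Fin 3), ∫⁻ y in ball x₀ 1, ‖u t y‖ₑ ^ 2 ≤ Cb :=
    (ae_restrict_mem measurableSet_Ioo).mono fun t ht x₀ => huC t ⟨ht.1.le, ht.2.le⟩ x₀
  have hpl : LocallyIntegrableOn (uncurry p)
      (Ioo (0 : ℝ) σ ×ˢ (univ : Set (EuclideanSpace ℝ (Fin 3)))) volume :=
    hsuit.distributional.2.2.1
  have hum : AEStronglyMeasurable (uncurry u)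
      (volume.restrict (Ioo (0 : ℝ) σ ×ˢ (univ : Set (EuclideanSpace ℝ (Fin 3))))) :=
    hsuit.distributional.1.aestronglyMeasurable
  have hpm : AEStronglyMeasurable (uncurry p)
      (volume.restrict (Ioo (0 : ℝ) σ ×ˢ (univ : Set (EuclideanSpace ℝ (Fin 3))))) :=
    hpl.aestronglyMeasurable
  -- `u ∈ L³((0,σ) × B_R)` from (7.3.2)
  have hu3 : ∀ Rb : ℝ, 0 < Rb → ∫⁻ z in Ioo 0 σ ×ˢ ball (0 : EuclideanSpace ℝ (Fin 3)) Rb,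
      ‖u z.1 z.2‖ₑ ^ (3 : ℕ) < ∞ := by
    intro Rb hRb
    obtain ⟨k, hk⟩ := ((hL3 Rb hRb).eventually (gt_mem_nhds (zero_lt_one' ℝ≥0∞))).exists
    have h3k : ∫⁻ z in Ioo 0 σ ×ˢ ball (0 : EuclideanSpace ℝ (Fin 3)) Rb,
        ‖w k z.1 z.2‖ₑ ^ (3 : ℕ) < ∞ := (hw k).lintegral_cube_box_lt_top 0 Rb
    set μB : Measure (ℝ × EuclideanSpace ℝ (Fin 3)) :=
      volume.restrict (Ioo 0 σ ×ˢ ball (0 : EuclideanSpace ℝ (Fin 3)) Rb) with hμB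
    have hμB : μB ≤ volume.restrict (Ioo (0 : ℝ) σ ×ˢ (univ : Set (EuclideanSpace ℝ (Fin 3)))) :=
      Measure.restrict_mono (prod_mono Subset.rfl (subset_univ _)) le_rfl
    have hwe : AEMeasurable (fun z : ℝ × EuclideanSpace ℝ (Fin 3) => ‖w k z.1 z.2‖ₑ ^ (3 : ℕ)) μB :=
      (((hw k).aestronglyMeasurable.mono_measure hμB).enorm.pow_const _)
    have hde : AEMeasurable (fun z : ℝ × EuclideanSpace ℝ (Fin 3) =>
        ‖w k z.1 z.2 - u z.1 z.2‖ₑ ^ (3 : ℕ)) μB :=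
      ((((hw k).aestronglyMeasurable.sub hum).mono_measure hμB).enorm.pow_const _)
    have hptw : ∀ z : ℝ × EuclideanSpace ℝ (Fin 3), ‖u z.1 z.2‖ₑ ^ (3 : ℕ) ≤
        (2 : ℝ≥0∞) ^ ((3 : ℝ) - 1) * (‖w k z.1 z.2‖ₑ ^ (3 : ℕ) + ‖w k z.1 z.2 - u z.1 z.2‖ₑ ^ (3 : ℕ)) := by
      intro z
      have hsub : ‖u z.1 z.2‖ₑ ≤ ‖w k z.1 z.2‖ₑ + ‖w k z.1 z.2 - u z.1 z.2‖ₑ := by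
        have e : u z.1 z.2 = w k z.1 z.2 - (w k z.1 z.2 - u z.1 z.2) := by rw [sub_sub_cancel]
        calc ‖u z.1 z.2‖ₑ = ‖w k z.1 z.2 - (w k z.1 z.2 - u z.1 z.2)‖ₑ := by rw [← e]
          _ ≤ ‖w k z.1 z.2‖ₑ + ‖w k z.1 z.2 - u z.1 z.2‖ₑ := enorm_sub_le
      have h := ENNReal.rpow_add_le_mul_rpow_add_rpow (‖w k z.1 z.2‖ₑ) (‖w k z.1 z.2 - u z.1 z.2‖ₑ)
        (by norm_num : (1 : ℝ) ≤ 3)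
      rw [show ((3 : ℝ)) = ((3 : ℕ) : ℝ) by norm_num, ENNReal.rpow_natCast, ENNReal.rpow_natCast,
        ENNReal.rpow_natCast] at h
      exact (pow_le_pow_left' hsub 3).trans (by exact_mod_cast h)
    calc ∫⁻ z in Ioo 0 σ ×ˢ ball (0 : EuclideanSpace ℝ (Fin 3)) Rb, ‖u z.1 z.2‖ₑ ^ (3 : ℕ)
        ≤ ∫⁻ z in Ioo 0 σ ×ˢ ball (0 : EuclideanSpace ℝ (Fin 3)) Rb, (2 : ℝ≥0∞) ^ ((3 : ℝ) - 1) *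
            (‖w k z.1 z.2‖ₑ ^ (3 : ℕ) + ‖w k z.1 z.2 - u z.1 z.2‖ₑ ^ (3 : ℕ)) := lintegral_mono hptw
      _ = (2 : ℝ≥0∞) ^ ((3 : ℝ) - 1) *
            ((∫⁻ z in Ioo 0 σ ×ˢ ball (0 : EuclideanSpace ℝ (Fin 3)) Rb, ‖w k z.1 z.2‖ₑ ^ (3 : ℕ)) +
              ∫⁻ z in Ioo 0 σ ×ˢ ball (0 : EuclideanSpace ℝ (Fin 3)) Rb,
                ‖w k z.1 z.2 - u z.1 z.2‖ₑ ^ (3 : ℕ)) := by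
          have hsum : AEMeasurable (fun z : ℝ × EuclideanSpace ℝ (Fin 3) =>
              ‖w k z.1 z.2‖ₑ ^ (3 : ℕ) + ‖w k z.1 z.2 - u z.1 z.2‖ₑ ^ (3 : ℕ)) μB := hwe.add hde
          rw [lintegral_const_mul'' _ hsum, lintegral_add_left' hwe]
      _ < ∞ := ENNReal.mul_lt_top (ENNReal.rpow_lt_top_of_nonneg (by norm_num) ENNReal.ofNat_ne_top)
          (ENNReal.add_lt_top.2 ⟨h3k, hk.trans ENNReal.one_lt_top⟩)
  have hF := fun (δ : ℝ) (hδ : 0 < δ) (η' : ℝ → ℝ) (hη' : ContDiff ℝ (⊤ : ℕ∞) η')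
      (hη'c : HasCompactSupport η') (hη'T : tsupport η' ⊆ Ioo 0 σ) (c₀ e : EuclideanSpace ℝ (Fin 3)) =>
    Seregin2014Limit.limit_pgFunctional_eq_zero Cb hw hwC hpl hum huA hL2 hpress hδ hη' hη'c hη'T c₀ e
  have hexp := Seregin2014Limit.limit_ae_slice_pressure_expansion hum hpm hp ENNReal.coe_ne_top huA
    hu3 hF
  have hdecay := seregin2014_limit_decay_holds one_pos hσ Cb aL u p
    (memE2_of_memLp haL.1 (by norm_num) (by norm_num)) haLdiv hsuit hp hmeas huC huG hwc hinit
    (fun x₀ r hr => hexp.mono fun t ht => ht x₀ r hr)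
  -- ### the limit is a local energy solution on `[0, σ]`
  have hsol : IsLocalEnergySolutionOn σ 1 aL u p :=
    { suitable := hsuit
      pressure := hp
      sliceMeasurable := hmeas
      uniformLocalEnergy := ⟨Cb, huC⟩
      uniformLocalGradient := huG.imp fun G hG' => ⟨hG'.1, Cb, hG'.2⟩
      weakContinuous := hwc
      initial := hinit
      decay := hdecay }
  exact ⟨Cb, φ, aL, u, p, hφ, hsol, haL.1, haL.2, hE, hGb, hL2⟩

/-- **Extraction of the limit local energy solution**, form with the layer hypothesis at every
smallness level (the statement of the first version of this file; it is the case `γ₁ = γ` of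
`exists_limit_localEnergySolution_of_le`). [cite: Seregin2014, Ch. 7 §7.3 (7.3.2)–(7.3.12) and App. B §B.4] [cite: LemarieRieusset2016, proof of Thm. 15.5, pp. 570–571] -/
theorem exists_limit_localEnergySolution
    (hLayer : ∀ (T : ℝ) (A P γ : ℝ≥0), 0 < T → T ≤ 1 →
      ∃ η : ℝ → ℝ≥0, Tendsto η (𝓝[>] 0) (𝓝 0) ∧
        ∀ (R : ℝ) (v₀ : EuclideanSpace ℝ (Fin 3) → EuclideanSpace ℝ (Fin 3))
          (v : ℝ → EuclideanSpace ℝ (Fin 3) → EuclideanSpace ℝ (Fin 3))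
          (π : ℝ → EuclideanSpace ℝ (Fin 3) → ℝ)
          (G : ℝ → EuclideanSpace ℝ (Fin 3) → EuclideanSpace ℝ (Fin 3) →L[ℝ] EuclideanSpace ℝ (Fin 3)),
          IsLocalEnergySolutionOn T 1 v₀ v π → MemLp v₀ 2 volume →
          eLpNorm v₀ 3 (volume.restrict (ball (0 : EuclideanSpace ℝ (Fin 3)) R)) ≤ γ →
          (∀ t ∈ Icc 0 T, ∀ x₀ : EuclideanSpace ℝ (Fin 3), ∫⁻ x in ball x₀ 1, ‖v t x‖ₑ ^ 2 ≤ A) →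
          HasWeakSpatialGradientOn (slab (EuclideanSpace ℝ (Fin 3)) (Ioo 0 T) isOpen_Ioo) v G →
          (∀ x₀ : EuclideanSpace ℝ (Fin 3), ∫⁻ z in Ioo 0 T ×ˢ ball x₀ 1,
            ENNReal.ofReal (frobeniusNormSq (G z.1 z.2)) ≤ A) →
          (∀ x₀ : EuclideanSpace ℝ (Fin 3), ∃ c : ℝ → ℝ,
            MemLp c (3 / 2 : ℝ≥0∞) (volume.restrict (Ioo 0 T)) ∧
            ∫⁻ z in Ioo 0 T ×ˢ ball x₀ 3, ‖π z.1 z.2 - c z.1‖ₑ ^ (3 / 2 : ℝ) ≤ P) →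
          ∀ x₀ : EuclideanSpace ℝ (Fin 3), ‖x₀‖ + 8 ≤ R → ∀ t ∈ Ioo 0 T,
            eLpNorm (v t - heatTest 1 v₀ t) 2 (volume.restrict (ball x₀ 1)) ≤ η t)
    {M γ : ℝ} (hM : 0 < M) (hγ : 0 < γ) :
    ∃ σ₀ : ℝ, 0 < σ₀ ∧ σ₀ < 1 ∧ ∀ σ : ℝ, 0 < σ → σ ≤ σ₀ →
      ∀ (R : ℕ → ℝ) (v₀ : ℕ → EuclideanSpace ℝ (Fin 3) → EuclideanSpace ℝ (Fin 3))
        (v : ℕ → ℝ → EuclideanSpace ℝ (Fin 3) → EuclideanSpace ℝ (Fin 3))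
        (π : ℕ → ℝ → EuclideanSpace ℝ (Fin 3) → ℝ),
        Tendsto R atTop atTop →
        (∀ n, IsLocalEnergySolutionOn σ 1 (v₀ n) (v n) (π n)) →
        (∀ n, MemLp (v₀ n) 2 volume) →
        (∀ n, ∀ x₁ : EuclideanSpace ℝ (Fin 3),
          eLpNorm (v₀ n) 2 (volume.restrict (ball x₁ 1)) ≤ ENNReal.ofReal M) →
        (∀ n, eLpNorm (v₀ n) 3 (volume.restrict (ball (0 : EuclideanSpace ℝ (Fin 3)) (R n))) ≤
          ENNReal.ofReal γ) →
        ∃ (C : ℝ≥0) (φ : ℕ → ℕ) (aL : EuclideanSpace ℝ (Fin 3) → EuclideanSpace ℝ (Fin 3))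
          (u : ℝ → EuclideanSpace ℝ (Fin 3) → EuclideanSpace ℝ (Fin 3))
          (p : ℝ → EuclideanSpace ℝ (Fin 3) → ℝ),
          StrictMono φ ∧ IsLocalEnergySolutionOn σ 1 aL u p ∧ MemLp aL 3 volume ∧
          eLpNorm aL 3 volume ≤ ENNReal.ofReal γ ∧
          (∀ n, ∀ᵐ t ∂(volume.restrict (Ioo 0 σ)), ∀ x₀ : EuclideanSpace ℝ (Fin 3),
            ∫⁻ x in ball x₀ 1, ‖v n t x‖ₑ ^ 2 ≤ C) ∧
          (∀ n, ∃ G : ℝ → EuclideanSpace ℝ (Fin 3) → EuclideanSpace ℝ (Fin 3) →L[ℝ] EuclideanSpace ℝ (Fin 3),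
            HasWeakSpatialGradientOn (slab (EuclideanSpace ℝ (Fin 3)) (Ioo 0 σ) isOpen_Ioo) (v n) G ∧
              ∀ x₀ : EuclideanSpace ℝ (Fin 3), ∫⁻ z in Ioo 0 σ ×ˢ ball x₀ 1,
                ENNReal.ofReal (frobeniusNormSq (G z.1 z.2)) ≤ C) ∧
          ∀ Rb : ℝ, 0 < Rb →
            Tendsto (fun k => ∫⁻ z in Ioo 0 σ ×ˢ ball (0 : EuclideanSpace ℝ (Fin 3)) Rb,
              ‖v (φ k) z.1 z.2 - u z.1 z.2‖ₑ ^ 2) atTop (𝓝 0) :=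
  exists_limit_localEnergySolution_of_le (γ₁ := γ)
    (fun T A P γ' hT hT1 _ => hLayer T A P γ' hT hT1) hM hγ le_rfl

end BarkerPrange2020

end Literature.Analysis.FluidPDE

end
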